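import Literature.Analysis.FluidPDE.Tao2016AveragedNS.SplitCascadeTable
import Literature.Analysis.FluidPDE.TaoCascadeWaveletData
import HarnessLib

/-!
# Tao's cascade ODE with the squared modes doubled, VI: wavelet data with prescribed centre moduli,
# and the input-moduli gap of the split table on the split frame

T. Tao, *Finite time blowup for an averaged three-dimensional Navier–Stokes equation*, J. Amer.
Math. Soc. **29** (2016) 601–674 = arXiv:1402.0290v3, §4 p. 21 (the wavelet data `B₁,…,B_m`,
`ψ₁,…,ψ_m`), §3.2 p. 15 ("it is necessary to ensure that `ξ⁰₁, ξ⁰₂, ξ⁰₃` have distinct magnitudes in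
order to avoid … the failure of (c-nondeg)") and §3.9 (3.24) [`Tao2016AveragedNS`].

HONEST FRAMING (cell harvest/h2-tao-ladder, rung 1 of a ladder of MODEL equations; the interface
between the representation half "R1-a" and the dynamics half "R1-b"): the dynamics chain
(`SplitCascadeLocalBlowup.lean`) holds for EVERY seven-profile wavelet data; the representation half
(theory-1's `IsSplitLocalCascadeForm`: two-ball real supports of radius `ε₀/64`, and for every basic
term a gap `≥ ε₀/20` between the centre moduli of its two INPUT profiles) needs a specific frame.
This file PROVES the two elementary facts that frame rests on: (1) wavelet data in Tao's sense exist
with ANY prescribed centre moduli in `(1, 1+ε₀/2)` and arbitrarily small common radius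
(`exists_cascadeWaveletData_norm_center`, generalising the tree's `nonempty_cascadeWaveletData`, whose
centres all have modulus `1+ε₀/4` — the isosceles configuration); (2) with the moduli
`ρᵢ = 1 + (i+1)ε₀/20` (`splitModulus`), every NONZERO structure constant of the split table couples
two input wavelets whose centre moduli `(1+ε₀)^{μ₁}ρ_{i₁}`, `(1+ε₀)^{μ₂}ρ_{i₂}` differ by at least
`ε₀/20` (`splitCoeff_input_moduli_gap`: same scale by square-freeness, adjacent scales by the band
`ρ ∈ [1+ε₀/20, 1+7ε₀/20]`), and such a frame exists with radii `< ε₀/128`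
(`exists_splitFrame`). Nothing here is the representation theorem itself, and nothing concerns
Navier–Stokes.
-/

noncomputable section

open MeasureTheory Set Filter Metric FourierTransform
open scoped Topology RealInnerProductSpace Pointwise SchwartzMap

namespace Literature.Analysis.FluidPDE

namespace Tao2016

/-! ### Wavelet data with prescribed centre moduli -/

/-- **Wavelet data with prescribed centre moduli (PROVED).** For any `ε₀`, any moduli
`ρ₁,…,ρ_m ∈ (1, 1+ε₀/2)` and any `r₀ > 0` there are wavelet data in the sense of Tao's §4
(`CascadeWaveletData ε₀ m`: disjoint balls `±Bᵢ` in the annulus `{1 < |ξ| ≤ 1+ε₀/2}`, real Schwartz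
divergence-free profiles with real Fourier transforms supported on `Bᵢ ∪ -Bᵢ`, `‖ψᵢ‖ = 1`) whose
centres have exactly these moduli, `‖cᵢ‖ = ρᵢ`, and whose common radius is `< r₀`. Centres
`ρᵢ(cos θᵢ, sin θᵢ, 0)`, `θᵢ = (π/2)(i/m)`; profiles from the tree's `exists_profile`.
[cite: Tao2016AveragedNS, §4 p. 21] -/
theorem exists_cascadeWaveletData_norm_center {ε₀ : ℝ} {m : ℕ} (ρ : Fin m → ℝ)
    (hρ : ∀ i, 1 < ρ i ∧ ρ i < 1 + ε₀ / 2) {r₀ : ℝ} (hr₀ : 0 < r₀) :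
    ∃ 𝒟 : CascadeWaveletData ε₀ m, (∀ i, ‖𝒟.center i‖ = ρ i) ∧ ∀ i, 𝒟.radius i < r₀ := by
  have hρpos : ∀ i, 0 < ρ i := fun i => by linarith [(hρ i).1]
  set θ : Fin m → ℝ := fun i => Real.pi / 2 * ((i : ℝ) / m) with hθ
  have hθrange : ∀ i, 0 ≤ θ i ∧ θ i < Real.pi / 2 := by
    intro i
    have hm : (0 : ℝ) < m := by exact_mod_cast Fin.pos i
    have hi : ((i : ℕ) : ℝ) < m := by exact_mod_cast i.isLt
    refine ⟨by positivity, ?_⟩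
    calc Real.pi / 2 * ((i : ℝ) / m) < Real.pi / 2 * 1 := by
          gcongr
          rwa [div_lt_one hm]
      _ = Real.pi / 2 := mul_one _
  have hcos : ∀ i, 0 < Real.cos (θ i) := fun i =>
    Real.cos_pos_of_mem_Ioo ⟨by linarith [(hθrange i).1, Real.pi_pos], (hθrange i).2⟩
  set ξc : Fin m → EuclideanSpace ℝ (Fin 3) := fun i => ρ i • dirVec (θ i) with hξc
  have hnorm : ∀ i, ‖ξc i‖ = ρ i := fun i => by
    rw [hξc, norm_smul, norm_dirVec, mul_one, Real.norm_of_nonneg (hρpos i).le]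
  have hfst : ∀ i, ξc i 0 = ρ i * Real.cos (θ i) := fun i => by
    simp [hξc, dirVec_apply_zero]
  have hξc_ne : ∀ i, ξc i ≠ 0 := fun i => by
    rw [← norm_ne_zero_iff, hnorm]
    exact (hρpos i).ne'
  have hinner : ∀ i, ⟪e3, ξc i⟫ = 0 := fun i => by
    rw [hξc, inner_smul_right, inner_e3_dirVec, mul_zero]
  -- distinct, non-antipodal centres
  have hne1 : ∀ i j, i ≠ j → ξc i ≠ ξc j := by
    intro i j hij h
    apply hij
    have hρij : ρ i = ρ j := by rw [← hnorm i, ← hnorm j, h]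
    have h' : dirVec (θ i) = dirVec (θ j) := by
      have h2 : ρ i • dirVec (θ i) = ρ i • dirVec (θ j) := by
        have := h; simp only [hξc] at this; rwa [← hρij] at this
      exact smul_right_injective _ (hρpos i).ne' h2
    have hcosij : Real.cos (θ i) = Real.cos (θ j) := by
      rw [← dirVec_apply_zero, ← dirVec_apply_zero, h']
    have hθij : θ i = θ j := Real.injOn_cos ⟨(hθrange i).1, by linarith [(hθrange i).2, Real.pi_pos]⟩
      ⟨(hθrange j).1, by linarith [(hθrange j).2, Real.pi_pos]⟩ hcosij
    have hm : (0 : ℝ) < m := by exact_mod_cast Fin.pos i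
    have : ((i : ℕ) : ℝ) = (j : ℕ) := by
      have h2 := mul_left_cancel₀ (by positivity : Real.pi / 2 ≠ 0) hθij
      field_simp at h2
      exact h2
    exact Fin.ext (by exact_mod_cast this)
  have hne2 : ∀ i j, ξc i ≠ -ξc j := by
    intro i j h
    have h0 := congrArg (fun v : EuclideanSpace ℝ (Fin 3) => v 0) h
    simp only [PiLp.neg_apply, hfst] at h0
    nlinarith [hcos i, hcos j, hρpos i, hρpos j, mul_pos (hρpos i) (hcos i),
      mul_pos (hρpos j) (hcos j)]
  -- a common small radius
  have hsmall : ∀ d : ℝ, 0 < d → ∀ᶠ r in 𝓝[>] (0 : ℝ), r + r < d := fun d hd =>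
    ((eventually_lt_nhds (half_pos hd)).filter_mono nhdsWithin_le_nhds).mono fun r hr => by linarith
  have hlt : ∀ d : ℝ, 0 < d → ∀ᶠ r in 𝓝[>] (0 : ℝ), r < d := fun d hd =>
    (eventually_lt_nhds hd).filter_mono nhdsWithin_le_nhds
  have hev : ∀ᶠ r in 𝓝[>] (0 : ℝ), 0 < r ∧ r < r₀ ∧
      (∀ i, r < ρ i - 1 ∧ r ≤ 1 + ε₀ / 2 - ρ i) ∧
      (∀ i j, i ≠ j → r + r < dist (ξc i) (ξc j)) ∧ (∀ i j, r + r < dist (ξc i) (-ξc j)) := by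
    refine eventually_mem_nhdsWithin.and ((hlt r₀ hr₀).and ((eventually_all.2 fun i => ?_).and
      ((eventually_all.2 fun i => eventually_all.2 fun j => ?_).and
        (eventually_all.2 fun i => eventually_all.2 fun j => hsmall _ (dist_pos.2 (hne2 i j))))))
    · exact (hlt _ (by linarith [(hρ i).1])).and
        ((hlt _ (by linarith [(hρ i).2] : (0 : ℝ) < 1 + ε₀ / 2 - ρ i)).mono fun r hr => hr.le)
    · by_cases hij : i = j
      · exact Eventually.of_forall fun r h => absurd hij h
      · exact (hsmall _ (dist_pos.2 (hne1 i j hij))).mono fun r hr _ => hr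
  obtain ⟨r, hr0, hrr₀, hrρ, hr2, hr3⟩ := hev.exists
  -- the profiles
  choose ψ hψ using fun i => exists_profile (hξc_ne i) e3_ne_zero (hinner i) hr0
  refine ⟨{ center := ξc
            radius := fun _ => r
            ψ := ψ
            ball_subset := fun i ξ hξ => ?_
            disjoint := fun i j hij => ball_disjoint_ball (hr2 i j hij).le
            disjoint_neg := fun i j => ?_
            isDivFree := fun i => (hψ i).1
            fourier_im := fun i => (hψ i).2.1
            fourier_support := fun i => (hψ i).2.2.1
            norm_eq_one := fun i => (hψ i).2.2.2 }, hnorm, fun _ => hrr₀⟩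
  · rw [mem_ball] at hξ
    have h1 : ‖ξ‖ ≤ ‖ξc i‖ + dist ξ (ξc i) := norm_le_norm_add_const_of_dist_le le_rfl
    have h2 : ‖ξc i‖ - ‖ξ‖ ≤ dist ξ (ξc i) := by
      rw [dist_comm, dist_eq_norm]
      exact norm_sub_norm_le _ _
    rw [hnorm] at h1 h2
    obtain ⟨hr4, hr5⟩ := hrρ i
    constructor
    · linarith
    · linarith
  · rw [neg_ball]
    exact ball_disjoint_ball (hr3 i j).le

/-! ### Two-ball Fourier supports in the metric form, and their behaviour under dilation -/

/-- `dist ξ (-c) = dist (-ξ) c`. [folklore] -/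
private theorem dist_neg_right_eq (ξ c : EuclideanSpace ℝ (Fin 3)) : dist ξ (-c) = dist (-ξ) c := by
  rw [dist_eq_norm, dist_eq_norm, sub_neg_eq_add, ← norm_neg (-ξ - c), neg_sub, sub_neg_eq_add,
    add_comm]

/-- **The profiles of Tao's wavelet data have two-ball Fourier support in the metric form**: for
every `ξ` at distance `> rᵢ` from both `cᵢ` and `-cᵢ`, `ψ̂ᵢ(ξ) = 0` (the form in which the cell's
rung-1 statements phrase "Fourier support in `B(ζ,r) ∪ B(-ζ,r)`"). [cite: Tao2016AveragedNS, §4 p. 21] -/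
theorem CascadeWaveletData.fourier_eq_zero_of_lt_dist {ε₀ : ℝ} {m : ℕ} (𝒟 : CascadeWaveletData ε₀ m)
    (i : Fin m) {ξ : EuclideanSpace ℝ (Fin 3)} (h₁ : 𝒟.radius i < dist ξ (𝒟.center i))
    (h₂ : 𝒟.radius i < dist ξ (-𝒟.center i)) :
    𝓕 (FunctionSpaces.EuclideanSpace.complexify ∘ ⇑(𝒟.ψ i)) ξ = 0 := by
  refine 𝒟.fourier_support i ξ (fun h => ?_) (fun h => ?_)
  · rw [mem_ball] at h; linarith
  · rw [mem_ball, ← dist_neg_right_eq] at h; linarith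

/-- **Dilation scales a two-ball Fourier support**: if `ψ̂` vanishes at every `ξ` at distance `> r`
from `c` and from `-c`, then for `λ > 0` the Fourier transform of `Dil_λ ψ` vanishes at every `ξ` at
distance `> λr` from `λc` and from `-λc` (`𝓕(Dil_λψ)(ξ) = λ^{3/2}λ^{-3} ψ̂(ξ/λ)`,
`fourier_complexify_schwartzDil`). With `λ = 1+ε₀` this is the support of the scale-shifted profiles
`shiftProfile` of the cascade operator. [cite: Tao2016AveragedNS, §4 (4.1)] -/
theorem fourier_schwartzDil_eq_zero_of_lt_dist {lam : ℝˣ} (hlam : 0 < (lam : ℝ))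
    {ψ : 𝓢(EuclideanSpace ℝ (Fin 3), EuclideanSpace ℝ (Fin 3))} {c : EuclideanSpace ℝ (Fin 3)} {r : ℝ}
    (hψ : ∀ ξ : EuclideanSpace ℝ (Fin 3), r < dist ξ c → r < dist ξ (-c) →
      𝓕 (FunctionSpaces.EuclideanSpace.complexify ∘ ⇑ψ) ξ = 0)
    {ξ : EuclideanSpace ℝ (Fin 3)} (h₁ : (lam : ℝ) * r < dist ξ ((lam : ℝ) • c))
    (h₂ : (lam : ℝ) * r < dist ξ (-((lam : ℝ) • c))) :
    𝓕 (FunctionSpaces.EuclideanSpace.complexify ∘ ⇑(schwartzDil lam ψ)) ξ = 0 := by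
  rw [fourier_complexify_schwartzDil]
  suffices h0 : 𝓕 (FunctionSpaces.EuclideanSpace.complexify ∘ ⇑ψ) ((lam : ℝ)⁻¹ • ξ) = 0 by
    rw [h0, smul_zero, smul_zero]
  have hscale : ∀ v : EuclideanSpace ℝ (Fin 3),
      dist ((lam : ℝ)⁻¹ • ξ) v = (lam : ℝ)⁻¹ * dist ξ ((lam : ℝ) • v) := fun v => by
    have hv : (lam : ℝ)⁻¹ • ξ - v = (lam : ℝ)⁻¹ • (ξ - (lam : ℝ) • v) := by
      rw [smul_sub, smul_smul, inv_mul_cancel₀ hlam.ne', one_smul]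
    rw [dist_eq_norm, dist_eq_norm, hv, norm_smul, Real.norm_eq_abs, abs_of_pos (inv_pos.2 hlam)]
  refine hψ _ ?_ ?_
  · rw [hscale, lt_inv_mul_iff₀ hlam]; exact h₁
  · rw [hscale, smul_neg, lt_inv_mul_iff₀ hlam]; exact h₂

end Tao2016

namespace Tao2016AveragedNS

open TaoCascade Tao2016

/-! ### The split frame: moduli `ρᵢ = 1 + (i+1)ε₀/20` -/

/-- The centre moduli of the split frame: `ρᵢ = 1 + (i+1)ε₀/20`, `i = 0,…,6` (seven DISTINCT
moduli in the band `[1+ε₀/20, 1+7ε₀/20] ⊂ (1, 1+ε₀/2)`, consecutive gap `ε₀/20`; Tao's own frame may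
take equal moduli because dilation averaging is available, §3.2 p. 15).
[cite: Tao2016AveragedNS, §3.2 p. 15] -/
def splitModulus (ε₀ : ℝ) (i : Fin 7) : ℝ := 1 + ((i : ℕ) + 1 : ℝ) * ε₀ / 20

/-- The split moduli lie in Tao's annulus band `(1, 1+ε₀/2)`. [cite: Tao2016AveragedNS, §4 p. 21] -/
theorem splitModulus_mem {ε₀ : ℝ} (hε₀ : 0 < ε₀) (i : Fin 7) :
    1 < splitModulus ε₀ i ∧ splitModulus ε₀ i < 1 + ε₀ / 2 := by
  have hi : ((i : ℕ) : ℝ) ≤ 6 := by exact_mod_cast Nat.lt_succ_iff.1 i.isLt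
  have hi0 : (0 : ℝ) ≤ (i : ℕ) := by positivity
  unfold splitModulus
  constructor
  · have : 0 < ((i : ℕ) + 1 : ℝ) * ε₀ / 20 := by positivity
    linarith
  · nlinarith

/-- Distinct modes of the split frame have centre moduli at least `ε₀/20` apart.
[cite: Tao2016AveragedNS, §3.2 p. 15] -/
theorem splitModulus_gap_same {ε₀ : ℝ} (hε₀ : 0 < ε₀) {i j : Fin 7} (hij : i ≠ j) :
    ε₀ / 20 ≤ |splitModulus ε₀ i - splitModulus ε₀ j| := by
  have hne : ((i : ℕ) : ℝ) ≠ (j : ℕ) := by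
    intro h; exact hij (Fin.ext (by exact_mod_cast h))
  have hdiff : splitModulus ε₀ i - splitModulus ε₀ j = (((i : ℕ) : ℝ) - (j : ℕ)) * (ε₀ / 20) := by
    unfold splitModulus; ring
  rw [hdiff, abs_mul, abs_of_pos (by positivity : (0 : ℝ) < ε₀ / 20)]
  have h1 : (1 : ℝ) ≤ |((i : ℕ) : ℝ) - (j : ℕ)| := by
    rcases lt_or_gt_of_ne hne with h | h
    · have : ((i : ℕ) : ℝ) + 1 ≤ (j : ℕ) := by exact_mod_cast (show (i : ℕ) < j by exact_mod_cast h)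
      rw [abs_of_neg (by linarith)]; linarith
    · have : ((j : ℕ) : ℝ) + 1 ≤ (i : ℕ) := by exact_mod_cast (show (j : ℕ) < i by exact_mod_cast h)
      rw [abs_of_pos (by linarith)]; linarith
  nlinarith

/-- Modes of ADJACENT scales of the split frame have centre moduli at least `ε₀/20` apart:
`(1+ε₀)ρᵢ - ρⱼ ≥ (1+ε₀)(1+ε₀/20) - (1+7ε₀/20) ≥ ε₀/20`. [cite: Tao2016AveragedNS, §3.2 p. 15] -/
theorem splitModulus_gap_cross {ε₀ : ℝ} (hε₀ : 0 < ε₀) (i j : Fin 7) :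
    ε₀ / 20 ≤ (1 + ε₀) * splitModulus ε₀ i - splitModulus ε₀ j := by
  have hi0 : (0 : ℝ) ≤ (i : ℕ) := by positivity
  have hj : ((j : ℕ) : ℝ) ≤ 6 := by exact_mod_cast Nat.lt_succ_iff.1 j.isLt
  unfold splitModulus
  nlinarith [mul_nonneg hε₀.le hi0, sq_nonneg ε₀]

/-- **On the split frame, every nonzero structure constant of the split table couples two input
wavelets with centre moduli at least `ε₀/20` apart (PROVED).** For `μ ∈ S` and
`α♯_{i₁,i₂,i₃,μ} ≠ 0`, the two input wavelets `ψ_{i₁,n-μ₃+μ₁}`, `ψ_{i₂,n-μ₃+μ₂}` of the basic term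
have centre moduli `(1+ε₀)^{n-μ₃}·(1+ε₀)^{μ₁}ρ_{i₁}` and `(1+ε₀)^{n-μ₃}·(1+ε₀)^{μ₂}ρ_{i₂}`; at the
reference scale, `|(1+ε₀)^{μ₁}ρ_{i₁} - (1+ε₀)^{μ₂}ρ_{i₂}| ≥ ε₀/20` — at the same scale by
square-freeness (`splitCoeff_squareFree`: `i₁ ≠ i₂`) and distinct moduli, across adjacent scales by
the band. This is the "distinct magnitudes" input condition of §3.2 p. 15 for the split operator
WITHOUT dilation averaging. [cite: Tao2016AveragedNS, §3.2 p. 15] -/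
theorem splitCoeff_input_moduli_gap {ε₀ : ℝ} (hε₀ : 0 < ε₀) (K ε : ℝ) {i₁ i₂ i₃ : Fin 7}
    {μ : ℤ × ℤ × ℤ} (hμ : μ ∈ shiftSet) (hα : splitCoeff ε₀ K ε i₁ i₂ i₃ μ ≠ 0) :
    ε₀ / 20 ≤ |(1 + ε₀) ^ μ.1 * splitModulus ε₀ i₁ - (1 + ε₀) ^ μ.2.1 * splitModulus ε₀ i₂| := by
  have hsq := splitCoeff_squareFree ε₀ K ε
  simp only [mem_shiftSet_iff] at hμ
  rcases hμ with rfl | rfl | rfl | rfl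
  · -- μ = (0,0,0): same scale, `i₁ ≠ i₂` by square-freeness
    have hne : i₁ ≠ i₂ := fun h => hα (by subst h; exact hsq i₁ i₃ _ (by simp [mem_shiftSet_iff]) rfl)
    simpa using splitModulus_gap_same hε₀ hne
  · -- μ = (1,0,0): input 1 one scale up
    have h := splitModulus_gap_cross hε₀ i₁ i₂
    simp only [zpow_one, zpow_zero, one_mul]
    rw [abs_of_pos (by linarith)]
    exact h
  · -- μ = (0,1,0): input 2 one scale up
    have h := splitModulus_gap_cross hε₀ i₂ i₁
    simp only [zpow_one, zpow_zero, one_mul]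
    rw [abs_sub_comm, abs_of_pos (by linarith)]
    exact h
  · -- μ = (0,0,1): same scale (one below the output), `i₁ ≠ i₂` by square-freeness
    have hne : i₁ ≠ i₂ := fun h => hα (by subst h; exact hsq i₁ i₃ _ (by simp [mem_shiftSet_iff]) rfl)
    simpa using splitModulus_gap_same hε₀ hne

/-- **The split frame exists (PROVED)**: for `0 < ε₀` there are seven-profile wavelet data in Tao's
sense whose centres have the split moduli `‖cᵢ‖ = 1 + (i+1)ε₀/20` and whose common radius is
`< ε₀/128` (so that even the once-dilated balls have radius `< (1+ε₀)ε₀/128 ≤ ε₀/64` for `ε₀ ≤ 1`).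
[cite: Tao2016AveragedNS, §4 p. 21] -/
theorem exists_splitFrame {ε₀ : ℝ} (hε₀ : 0 < ε₀) :
    ∃ 𝒟 : CascadeWaveletData ε₀ 7, (∀ i, ‖𝒟.center i‖ = splitModulus ε₀ i) ∧
      ∀ i, 𝒟.radius i < ε₀ / 128 :=
  exists_cascadeWaveletData_norm_center (splitModulus ε₀) (splitModulus_mem hε₀) (by positivity)

end Tao2016AveragedNS

end Literature.Analysis.FluidPDE
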